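import Literature.MathematicalPhysics.QuantumFieldTheory.Balaban1983to89.B9Thm310GTorusRegularCover
import Literature.MathematicalPhysics.QuantumFieldTheory.Balaban1983to89.B9Thm310CutoffGradTermsB
import Literature.MathematicalPhysics.QuantumFieldTheory.Balaban1983to89.B9Thm310CutoffDivTermsB
import Literature.MathematicalPhysics.QuantumFieldTheory.Balaban1983to89.B9Thm310CutoffLapTermsB

/-!
# `Balaban1983to89.B9Thm310GTorusRegularCoverCubes` — T. Bałaban, *Propagators for lattice gauge theories in a background field*, Commun. Math. Phys. **99** (1985)
# 389–434 [Balaban1985BackgroundPropagators], Theorem 3.10 ⇒ Theorem 3.3 (3.42) for `G(U) = Δ_a(U)⁻¹` AT THE CUBE COVER OF RECORD with ALL the cut-off (Leibniz) cube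
# terms DISCHARGED: FILE 6-B's block endpoint with the `hTE`∕`hKE` (4a-B), `hTF`∕`hKF` (4b-B) and `hTL`∕`hKL` (4c-B) slots filled from the cube letters' blocks `hE` — the
# consumer-facing (3.42) block of M5.7 modulo the transposed remainder and families 2–4 of `R` (sub-row G-B9-LETTERS, M5.7, the 6-B plug-in)

statement-level skeleton of published theorems with citation tags; proofs where landed; nothing here is a claim about the Yang–Mills mass gap

PDF held: `paper:balaban1985-cmp99-background-propagators` (journal page = PDF page + 388); pp. 397, 399, 409–410, 413–416 read from the held text layer.

THE PRINT.  p. 416 «Theorem 3.10 implies Theorem 3.3»; p. 399 Thm 3.3 «the operator G(U) (a = 1) satisfies the inequalities (3.42)–(3.47) … The constants in the inequalities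
depend on d and L only»; p. 413 (3.100) (the cut-offs pass through `D_U`, `D*_U` at the cost of first-order terms «of the order O(M⁻¹)», p. 414 l.1–2); p. 397 (3.42).

WHY THIS FILE (cell context: G-B9-LETTERS M5.7).  FILE 6-B `B9Thm310GTorusRegularCover.eBlock_kernelFamilyBInv_GAY_of_cover` displays, per direction and cube, the Leibniz
majorants `hTE`∕`hTF`∕`hTL` with their sums `hKE`∕`hKF`∕`hKL`; FILE 4a-B `B9Thm310CutoffGradTermsB`, FILE 4b-B `B9Thm310CutoffDivTermsB` and FILE 4c-B
`B9Thm310CutoffLapTermsB` produce exactly these from the cube letters' (3.42) blocks over the class `hE`, bi-contractivity and `η = |c_f|⁻¹`, on FILE 3-B's localisation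
sets with the overlap count `N′ = 3·5^{d+1}e^{αδ₀(2L+4)}c₁(α)` and the neighbourhood count `m_N = e^{αδ₀}c₁(α)` (both from [4] (2.61)).  THIS FILE plugs them in:
★★★ `eBlock_kernelFamilyBInv_GAY_of_coverCubes` — `EBlock (kernelFamilyBInv i B cfg (GAY i parS parB Gp) par) (M₂(Σ‖b_j‖)·Bc) ((1−2α)δ₀) U₁` with
`A₁ = N′·M₂(Σ‖b_j‖)·B₀(1 + 5C1F·L·e^{δ₀}∕(8M_h))`, `A₂ = N′·M₂(Σ‖b_j‖)·B₀(1 + m_N e^{δ₀}(5∕8)C1F∕M_h)`, `A₃ = N′·M₂(Σ‖b_j‖)·B₀(1 + (d+1)((5∕8)(C1F∕M_h)(e^{δ₀}+1) + (25∕64)C2F∕M_h²))`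
written out, for ANY ℝ-linear `D_ν`, `D*_ν`, `L` agreeing with `cdB`, `cdsB`, `lapB` at `U = cfg U₁`.

WHAT IS PROVED (all `theorem`s, 0 `def`, 0 sorry).  ★★★ `eBlock_kernelFamilyBInv_GAY_of_coverCubes`.
HONEST SCOPE.  STILL DISPLAYED (by name): `hE` (Cor. 3.6 ∕ Thm 3.3 blocks of every cube letter `G_□(U)` — M5.1b-bond), `hrest` (families 2–4 of `R`: p. 415 walk
re-expansion ∕ (3.101)), `hV` (the transposed remainder, PLAN 5), `hinvU`, `hinvC`, `ζ`, bi-contractivity `hU`∕`hT` (unitary fibre), the plaquette datum `hW` (print's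
(3.35): `…DataOfPlaquettes.plaquetteDefect_of_reg335P`), `η = |c_f|⁻¹`, `0 ≤ b₁`, [4] Lemma 2.1 (`h261`, `h263`), the two smallness conditions.  Nothing continuum ∕ OS ∕ mass gap ∕ Clay; YM mass gap NOT proved by any of this (Track A conditional rung).  `--supports stmt-QuantumFields-19200`.
Net new unproved facts: 0.
-/

noncomputable section

namespace Literature.MathematicalPhysics.QuantumFieldTheory.Balaban1983to89.B9Thm310GTorusRegularCoverCubes

open Node00 B9CubeLettersInvReadings
open B6GlobalChartV1 (blkV1)
open B6Ineq2142KLevelV1 (β)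
open B6KLevelCensusIndexV1 (KIdx)
open B6Geom246MultiLevelTorus (bondT)
open B6Cover236MultiLevelBlocks (cubes)
open B6Partition118KLevelTorusCentral (QT)
open B6Partition118KLevelFineSizes (C1F C1F_nonneg)
open B6Partition118KLevelFineSecond (C2F C2F_nonneg)
open B6RandomWalk (HasMajorant Ineq261 Ineq263 c1_nonneg)
open B9Thm34Ext (toB6)
open B9FromB6 (EBlock)
open B9GeoNormsKLevelV1 (geo9K)
open B9Eq352DivFormLetters (conj)
open B9Thm37Sum (mulOp)
open B9Thm37CubeCoverCommutators (cutMulY hTY)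
open B9Thm37CubeCoverCommutatorSizes (four_le_P')
open B9Eq3104CutoffCommutators (hBdY KhBY DPDsY)
open B9CubeLettersBondOpsL0 (deltaACubeY GACubeY)
open B9Eq3105AtLetters (DPDsCubeY P1CubeY)
open B9Thm310CommutatorBound389B (theta389B)
open B9Thm310GTorusRegularCover (eBlock_kernelFamilyBInv_GAY_of_cover)
open B9Thm310CutoffGradTermsB (hasMajorant_conj_gradTermB sum_gradTermB_majorant_le)
open B9Thm310CutoffDivTermsB (hasMajorant_conj_divTermB sum_divTermB_majorant_le card_near_le_of_ineq261)
open B9Thm310CutoffLapTermsB (hasMajorant_conj_lapTermB sum_lapTermB_majorant_le)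
open Node00.OpsYNablaBridge (chartY)
open scoped Matrix

variable {d ℓ : ℕ} {hd : 1 ≤ d + 1} {hL : Odd (ℓ + 1) ∧ 1 < ℓ + 1} {b₀ b₁ : ℝ}
variable {𝔸 : Type} [NormedRing 𝔸] [NormedAlgebra ℂ 𝔸] [CompleteSpace 𝔸]
variable {ι : Type} [Fintype ι] [DecidableEq ι]
variable (i : KIdx d ℓ hd hL b₀ b₁) (b : Module.Basis ι ℝ 𝔸)
variable [Fintype (geo9K i).Site] [DecidableEq (geo9K i).Site] {Rr : ℝ} {Hp : Prop}
variable (ιB : BlkY i → IBondY i)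
variable {B : B9.Backgrounds} (cfg : B.Cfg → CfgY 𝔸 i) (par : BondParY 𝔸 i) {U₁ : B.Cfg}

/-- ★★★ **THEOREM 3.10 ⇒ THE (3.42) BLOCK OF `kernelFamilyBInv … (GAY i parS parB Gp) …` AT THE COVER OF RECORD, ALL CUT-OFF CUBE TERMS AND THE FIRST FAMILY OF `R`
DISCHARGED**: FILE 6-B's `eBlock_kernelFamilyBInv_GAY_of_cover` with `KE ν □`, `A₁` from FILE 4a-B (`hasMajorant_conj_gradTermB`, `sum_gradTermB_majorant_le`),
`KF ν □`, `A₂` from FILE 4b-B (`hasMajorant_conj_divTermB`, `sum_divTermB_majorant_le`, neighbourhood count `m_N = e^{αδ₀}c₁(α)` by `card_near_le_of_ineq261`) and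
`KL □`, `A₃` from FILE 4c-B (`hasMajorant_conj_lapTermB`, `sum_lapTermB_majorant_le`), for ANY ℝ-linear `D_ν`, `D*_ν`, `L` agreeing with `cdB`, `cdsB`, `lapB` at
`U = cfg U₁`.  Output: `EBlock (kernelFamilyBInv i B cfg (GAY i parS parB Gp) par) (M₂(Σ‖b_j‖)·Bc) ((1−2α)δ₀) U₁` with
`Bc = (N·B₀′ + A₁ + A₃)c₁(1 − (Θ₁+Θ′)c₁)⁻¹ + A₂c₁(1 − θ_Vc₁)⁻¹`, `N = 3·5^{d+1}`, `B₀′ = M₂(Σ‖b_j‖)B₀`, `N′ = 3·5^{d+1}e^{αδ₀(2L+4)}c₁(α)`,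
`A₁ = N′·M₂(Σ‖b_j‖)·B₀(1 + 5C1F·L·e^{δ₀}∕(8M_h))`, `A₂ = N′·M₂(Σ‖b_j‖)·B₀(1 + m_N e^{δ₀}(5∕8)C1F∕M_h)`, `A₃ = N′·M₂(Σ‖b_j‖)·B₀(1 + (d+1)((5∕8)(C1F∕M_h)(e^{δ₀}+1) + (25∕64)C2F∕M_h²))`.
[cite: Balaban1985BackgroundPropagators, Thm 3.3 p.399 (3.42) p.397 via Thm 3.10 pp.414–416, (3.100) p.413; Balaban1984PropagatorsII, Prop. 2.2 (2.67) p.234, Lemma 2.1 (2.61) p.234] -/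
theorem eBlock_kernelFamilyBInv_GAY_of_coverCubes (hι : ∀ s, β i.hN i.D i.hk (ιB s) = s)
    {M₂ : ℝ} (hM₂ : 0 ≤ M₂) (hrepr : ∀ (v : 𝔸) (j : ι), |b.repr v j| ≤ M₂ * ‖v‖) (hη : etaS i = |i.cf|⁻¹) (hb₁ : 0 ≤ b₁)
    (parS : SiteParY 𝔸 i) (parB : BondParY 𝔸 i) (Gp : SiteOpY 𝔸 i)
    (ζ : ↥(cubes i.D.toDomains) → SiteY i → ℝ) (hζ : ∀ c z, hTY i c z ≠ 0 → ζ c z = 1)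
    (hinvC : ∀ c : ↥(cubes i.D.toDomains), IsUnit (deltaACubeY i c parS parB (cfg U₁))) (hinvU : IsUnit (deltaAY i parS parB Gp (cfg U₁)))
    (D Ds : Fin (d + 1) → Module.End ℝ (FBondY i → 𝔸)) (hD : ∀ ν Λ, D ν Λ = cdB i (cfg U₁) ν Λ) (hDs : ∀ ν Λ, Ds ν Λ = cdsB i (cfg U₁) ν Λ)
    (Lp : Module.End ℝ (FBondY i → 𝔸)) (hLp : ∀ Λ, Lp Λ = lapB i (cfg U₁) Λ)
    (d' : ℕ) {δ₀ α Θ' θV B₀ δh : ℝ}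
    (hB₀ : 0 ≤ B₀) (hδ₀ : 0 ≤ δ₀) (hΘ' : 0 ≤ Θ') (hθV : 0 ≤ θV) (hδh : 0 ≤ δh)
    (hαδ : 0 ≤ α * δ₀) (hαδ2 : 0 ≤ (1 - 2 * α) * δ₀)
    (h261 : Ineq261 d' (toB6 (geo9K i) Rr Hp) δ₀ α) (h263 : Ineq263 d' (toB6 (geo9K i) Rr Hp) δ₀ α)
    (hsmall : ((3 * 5 ^ (d + 1) * (Real.exp (α * δ₀ * (2 * (ℓ : ℝ) + 6)) * B6.c1 d' δ₀ α)) *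
        (M₂ * (∑ j, ‖b j‖) * theta389B d ℓ B₀ b₁ δ₀ 1 (2 * δh) (δh * (((ℓ : ℝ) + 1) ^ 2 + 1)) δh 0 * ((geo9K i).M)⁻¹) + Θ') * B6.c1 d' δ₀ α < 1)
    (hsmallV : θV * B6.c1 d' δ₀ α < 1)
    (hE : ∀ c : ↥(cubes i.D.toDomains), EBlock (kernelFamilyBInv i B cfg (GACubeY i c parS parB) par) B₀ δ₀ U₁)
    (hU : ∀ μ x, ‖(cfg U₁ μ x : 𝔸)‖ ≤ 1 ∧ ‖(((cfg U₁ μ x)⁻¹ : 𝔸ˣ) : 𝔸)‖ ≤ 1)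
    (hT : ∀ (y : IBondY i) (f : FBondY i), ‖(qT i parB (cfg U₁) y f : 𝔸)‖ ≤ 1 ∧ ‖(((qT i parB (cfg U₁) y f)⁻¹ : 𝔸ˣ) : 𝔸)‖ ≤ 1)
    (hW : ∀ p : PlaqY i, ‖((holY i (cfg U₁) p : 𝔸ˣ) : 𝔸) - 1‖ ≤ δh * ((((ℓ : ℝ) + 1) ^ levY i (chartY i p.src))⁻¹) ^ 2)
    (hrest : HasMajorant (g := toB6 (geo9K i) Rr Hp) (fun p : FBondY i × ι => ιB (blkV1 i.hN i.D p.1))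
      (∑ c, conj b (((1 - cutMulY (hBdY i (ζ c))) * DPDsY i parS Gp (cfg U₁) *
            (cutMulY (hBdY i (hTY i c)) * GACubeY i c parS parB (cfg U₁) * cutMulY (hBdY i (hTY i c)))).restrictScalars ℝ)
        + ∑ c, conj b ((cutMulY (hBdY i (ζ c)) * (DPDsY i parS Gp (cfg U₁) - DPDsCubeY i c parS (cfg U₁)) *
            (cutMulY (hBdY i (hTY i c)) * GACubeY i c parS parB (cfg U₁) * cutMulY (hBdY i (hTY i c)))).restrictScalars ℝ)
        + ∑ c, conj b ((cutMulY (hBdY i (ζ c)) * P1CubeY i c (hTY i c) parS (cfg U₁) * GACubeY i c parS parB (cfg U₁) *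
            cutMulY (hBdY i (hTY i c))).restrictScalars ℝ))
      (fun a a' => Θ' * Real.exp (-(δ₀ * (geo9K i).dist a a'))))
    (hV : HasMajorant (g := toB6 (geo9K i) Rr Hp) (fun p : FBondY i × ι => ιB (blkV1 i.hN i.D p.1))
      (-(∑ c, conj b ((cutMulY (hBdY i (hTY i c)) * GACubeY i c parS parB (cfg U₁) * KhBY i (hTY i c) parB (cfg U₁)).restrictScalars ℝ))
        - ∑ c, conj b ((cutMulY (hBdY i (hTY i c)) * GACubeY i c parS parB (cfg U₁) * P1CubeY i c (hTY i c) parS (cfg U₁)).restrictScalars ℝ)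
        + ∑ c, conj b ((cutMulY (hBdY i (hTY i c)) * GACubeY i c parS parB (cfg U₁) * cutMulY (hBdY i (hTY i c)) *
            (cutMulY (hBdY i (ζ c)) * (DPDsY i parS Gp (cfg U₁) - DPDsCubeY i c parS (cfg U₁)))).restrictScalars ℝ)
        + ∑ c, conj b ((cutMulY (hBdY i (hTY i c)) * GACubeY i c parS parB (cfg U₁) * cutMulY (hBdY i (hTY i c)) *
            ((1 - cutMulY (hBdY i (ζ c))) * DPDsY i parS Gp (cfg U₁))).restrictScalars ℝ))
      (fun a a' => θV * (geo9K i).len a * ((geo9K i).len a')⁻¹ * Real.exp (-(δ₀ * (geo9K i).dist a a')))) :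
    EBlock (kernelFamilyBInv i B cfg (GAY i parS parB Gp) par)
      (M₂ * (∑ j, ‖b j‖) *
        ((3 * 5 ^ (d + 1)) * (M₂ * (∑ j, ‖b j‖) * B₀) * B6.c1 d' δ₀ α *
            (1 - ((3 * 5 ^ (d + 1) * (Real.exp (α * δ₀ * (2 * (ℓ : ℝ) + 6)) * B6.c1 d' δ₀ α)) *
              (M₂ * (∑ j, ‖b j‖) * theta389B d ℓ B₀ b₁ δ₀ 1 (2 * δh) (δh * (((ℓ : ℝ) + 1) ^ 2 + 1)) δh 0 * ((geo9K i).M)⁻¹) + Θ') *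
              B6.c1 d' δ₀ α)⁻¹ +
          ((3 * 5 ^ (d + 1) * (Real.exp (α * δ₀ * (2 * (ℓ : ℝ) + 6)) * B6.c1 d' δ₀ α)) *
              (M₂ * (∑ j, ‖b j‖) * (B₀ * (1 + 5 * C1F d ℓ * (((ℓ : ℝ) + 1) * Real.exp δ₀) / (8 * (i.Mh : ℝ)))))) * B6.c1 d' δ₀ α *
            (1 - ((3 * 5 ^ (d + 1) * (Real.exp (α * δ₀ * (2 * (ℓ : ℝ) + 6)) * B6.c1 d' δ₀ α)) *
              (M₂ * (∑ j, ‖b j‖) * theta389B d ℓ B₀ b₁ δ₀ 1 (2 * δh) (δh * (((ℓ : ℝ) + 1) ^ 2 + 1)) δh 0 * ((geo9K i).M)⁻¹) + Θ') *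
              B6.c1 d' δ₀ α)⁻¹ +
          ((3 * 5 ^ (d + 1) * (Real.exp (α * δ₀ * (2 * (ℓ : ℝ) + 6)) * B6.c1 d' δ₀ α)) *
              (M₂ * (∑ j, ‖b j‖) * (B₀ * (1 + Real.exp (α * δ₀) * B6.c1 d' δ₀ α * Real.exp δ₀ * (5 / 8 * C1F d ℓ / i.Mh))))) * B6.c1 d' δ₀ α *
            (1 - θV * B6.c1 d' δ₀ α)⁻¹ +
          ((3 * 5 ^ (d + 1) * (Real.exp (α * δ₀ * (2 * (ℓ : ℝ) + 6)) * B6.c1 d' δ₀ α)) *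
              (M₂ * (∑ j, ‖b j‖) * (B₀ * (1 + ((d : ℝ) + 1) * (5 / 8 * C1F d ℓ / i.Mh * (Real.exp δ₀ + 1) + 25 / 64 * C2F d ℓ / i.Mh ^ 2))))) * B6.c1 d' δ₀ α *
            (1 - ((3 * 5 ^ (d + 1) * (Real.exp (α * δ₀ * (2 * (ℓ : ℝ) + 6)) * B6.c1 d' δ₀ α)) *
              (M₂ * (∑ j, ‖b j‖) * theta389B d ℓ B₀ b₁ δ₀ 1 (2 * δh) (δh * (((ℓ : ℝ) + 1) ^ 2 + 1)) δh 0 * ((geo9K i).M)⁻¹) + Θ') *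
              B6.c1 d' δ₀ α)⁻¹))
      ((1 - 2 * α) * δ₀) U₁ := by
  classical
  have hSb : 0 ≤ ∑ j, ‖b j‖ := Finset.sum_nonneg fun _ _ => norm_nonneg _
  have hC1F : 0 ≤ C1F d ℓ := C1F_nonneg d ℓ
  have hC2F : 0 ≤ C2F d ℓ := C2F_nonneg d ℓ
  have hc1 : 0 ≤ B6.c1 d' δ₀ α := c1_nonneg d' δ₀ α
  have hN' : 0 ≤ 3 * 5 ^ (d + 1) * (Real.exp (α * δ₀ * (2 * (ℓ : ℝ) + 6)) * B6.c1 d' δ₀ α) := by positivity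
  have hmN : 0 ≤ Real.exp (α * δ₀) * B6.c1 d' δ₀ α := by positivity
  have hA₁ : 0 ≤ (3 * 5 ^ (d + 1) * (Real.exp (α * δ₀ * (2 * (ℓ : ℝ) + 6)) * B6.c1 d' δ₀ α)) *
      (M₂ * (∑ j, ‖b j‖) * (B₀ * (1 + 5 * C1F d ℓ * (((ℓ : ℝ) + 1) * Real.exp δ₀) / (8 * (i.Mh : ℝ))))) :=
    mul_nonneg hN' (mul_nonneg (mul_nonneg hM₂ hSb) (mul_nonneg hB₀ (by positivity)))
  have hA₂ : 0 ≤ (3 * 5 ^ (d + 1) * (Real.exp (α * δ₀ * (2 * (ℓ : ℝ) + 6)) * B6.c1 d' δ₀ α)) *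
      (M₂ * (∑ j, ‖b j‖) * (B₀ * (1 + Real.exp (α * δ₀) * B6.c1 d' δ₀ α * Real.exp δ₀ * (5 / 8 * C1F d ℓ / i.Mh)))) :=
    mul_nonneg hN' (mul_nonneg (mul_nonneg hM₂ hSb) (mul_nonneg hB₀ (by positivity)))
  have hA₃ : 0 ≤ (3 * 5 ^ (d + 1) * (Real.exp (α * δ₀ * (2 * (ℓ : ℝ) + 6)) * B6.c1 d' δ₀ α)) *
      (M₂ * (∑ j, ‖b j‖) * (B₀ * (1 + ((d : ℝ) + 1) * (5 / 8 * C1F d ℓ / i.Mh * (Real.exp δ₀ + 1) + 25 / 64 * C2F d ℓ / i.Mh ^ 2)))) :=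
    mul_nonneg hN' (mul_nonneg (mul_nonneg hM₂ hSb) (mul_nonneg hB₀ (by positivity)))
  -- the neighbourhood count `m_N` of FILE 4b-B from (2.61)
  have hnbr : ∀ y' : IBondY i, ((((Finset.univ : Finset ((geo9K i).Site)).filter fun a => (geo9K i).dist a y' ≤ 1).card : ℕ) : ℝ) ≤
      Real.exp (α * δ₀) * B6.c1 d' δ₀ α := fun y' => card_near_le_of_ineq261 i d' hαδ h261 y'
  exact eBlock_kernelFamilyBInv_GAY_of_cover i b ιB cfg par hι hM₂ hrepr hη hb₁ parS parB Gp ζ hζ hinvC hinvU D Ds hD hDs Lp hLp d'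
    (fun ν c => fun a a' => if (∃ y ∈ QT i.D (B9GeoLemma21KLevelV1.one_le_Mh i) (four_le_P' i) c,
          (((bondT i.D).dist (β i.hN i.D i.hk a) y : ℕ) : ℝ) ≤ 2 * (ℓ : ℝ) + 6)
        then M₂ * (∑ j, ‖b j‖) * (B₀ * (1 + 5 * C1F d ℓ * (((ℓ : ℝ) + 1) * Real.exp δ₀) / (8 * (i.Mh : ℝ)))) * (geo9K i).len a
          * Real.exp (-(δ₀ * (geo9K i).dist a a')) else 0)
    (fun ν c => fun a a' => if (∃ y ∈ QT i.D (B9GeoLemma21KLevelV1.one_le_Mh i) (four_le_P' i) c,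
          (((bondT i.D).dist (β i.hN i.D i.hk a) y : ℕ) : ℝ) ≤ 2 * (ℓ : ℝ) + 6)
        then M₂ * (∑ j, ‖b j‖) * (B₀ * (1 + Real.exp (α * δ₀) * B6.c1 d' δ₀ α * Real.exp δ₀ * (5 / 8 * C1F d ℓ / i.Mh))) * (geo9K i).len a
          * Real.exp (-(δ₀ * (geo9K i).dist a a')) else 0)
    (fun c => fun a a' => if (∃ y ∈ QT i.D (B9GeoLemma21KLevelV1.one_le_Mh i) (four_le_P' i) c,
          (((bondT i.D).dist (β i.hN i.D i.hk a) y : ℕ) : ℝ) ≤ 2 * (ℓ : ℝ) + 6)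
        then M₂ * (∑ j, ‖b j‖) * (B₀ * (1 + ((d : ℝ) + 1) * (5 / 8 * C1F d ℓ / i.Mh * (Real.exp δ₀ + 1) + 25 / 64 * C2F d ℓ / i.Mh ^ 2)))
          * Real.exp (-(δ₀ * (geo9K i).dist a a')) else 0)
    hB₀ hδ₀ hΘ' hθV hδh hA₁ hA₂ hA₃ hαδ hαδ2 h261 h263 hsmall hsmallV hE hU hT hW hrest
    (fun ν c => hasMajorant_conj_gradTermB i b ιB cfg par (Rr := Rr) (Hp := Hp) hι hM₂ hrepr hη parS parB hB₀ hδ₀ c (hE c) hU ν (D ν) (hD ν))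
    (fun ν a a' => sum_gradTermB_majorant_le i b ιB (Rr := Rr) (Hp := Hp) hι hM₂ hB₀ d' hαδ h261 a a')
    (fun c => hasMajorant_conj_lapTermB i b ιB cfg par (Rr := Rr) (Hp := Hp) hι hM₂ hrepr hη parS parB hB₀ hδ₀ c (hE c) hU Lp hLp)
    (fun a a' => sum_lapTermB_majorant_le i b ιB (Rr := Rr) (Hp := Hp) hι hM₂ hB₀ d' hαδ h261 a a')
    (fun ν c => hasMajorant_conj_divTermB i b ιB cfg par (Rr := Rr) (Hp := Hp) hι hM₂ hrepr hη parS parB hB₀ hδ₀ c (hE c) hU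
      (fun y' : IBondY i => ((Finset.univ : Finset ((geo9K i).Site)).filter fun a => (geo9K i).dist a y' ≤ 1))
      (fun a y' h => Finset.mem_filter.2 ⟨Finset.mem_univ (α := (geo9K i).Site) a, h⟩) hmN hnbr ν (Ds ν) (hDs ν))
    (fun ν a a' => sum_divTermB_majorant_le i b ιB (Rr := Rr) (Hp := Hp) hι hM₂ hB₀ hmN d' hαδ h261 a a')
    hV

end Literature.MathematicalPhysics.QuantumFieldTheory.Balaban1983to89.B9Thm310GTorusRegularCoverCubes

end
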